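import Summits.ResolutionOfSingularities.ResolutionOfSingularities.Theorems.PurelyInseparableDim4ResConeSatellitePair
import HarnessLib
import HarnessLib.Audit.Tags

/-!
# Purely inseparable four-folds — the LIGHT-TAIL TRICHOTOMY (three boundary letters, one hit per step)
# (cell `res-dim4-pi`, K2(p) lane, slice B brick K26b)

[OURS · counted 0 · cell `res-dim4-pi` · K2(p) lane holder res-dim4-p-12 g3's brick by signature (bus
2026-08-29 01:16Z); statement and pigeonhole proof res-dim4-idea-4 g3 (01:15Z); seat res-dim4-p-9 g3.]
Nothing here proves K2(p)/K2(5), `NoIsolatedTrap p p` or resolution of singularities in dimension ≥ 4 /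
characteristic `p`; this is the ENTRY bookkeeping of the light regime (I-4-7 A∞/C∞), pure combinatorics of
the walk's letters `(r, j, b)` — no algebra.

* §1 CORE (`light_tail_trichotomy_core`), over an abstract alive-set walk `B : ℕ → Finset (Fin 4)` with the
  boundary law `i ∈ B (k+1) ↔ i = j k ∨ (i ∈ B k ∧ b k i = 0)` (`k ≥ k₀`) and `|B k| = 3`:
  every step HITS exactly the letters it re-creates or translates; the eventually-PERMANENT letters `P` (kept for
  ever) number `≤ 2`, every other alive letter is eventually BORN in the stretch (its current life began at a
  creation step `j t = i`, `t ≥ k₀`, and it was kept since); `|P| = 2` ⇒ (T1) FREE TAIL (`j (k+1) = j k ∨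
  b (k+1) (j k) ≠ 0` from some index on), `|P| = 1` ⇒ (T2) ONE IDLE letter `ν` and the two others born,
  `|P| = 0` ⇒ (T3) ALL THREE born.
* §2 DRESS (`light_tail_trichotomy`): for a witnessed isolated above-floor `Step0 p` chain the alive set
  `B k = supp r_k` obeys the law (`step_r_univ'`: the new letter gets weight `o_k − p ≥ 1`, a kept letter keeps
  its weight, a translated one is lost), so three alive letters from `k₀` on give (T1) `¬ FreeTail.IsSatellite`
  eventually ∨ (T2) ∨ (T3) — idea-4's `light_tail_trichotomy` with `hwt` weakened to `|supp r_k| = 3`.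

bears_on: LADDER-RESOLUTION:D157-DOOR2 (res-dim4-pi · K2(p) · slice B · K26b).  Supports
stmt-ResolutionOfSingularities-16155 (helper).
-/

set_option linter.dupNamespace false -- mandated namespace of this single-conjunct summit

noncomputable section

namespace Summit.ResolutionOfSingularities.ResolutionOfSingularities.Theorems.PIDim4

namespace ResCone

open MvPolynomial Finset
open Literature.AlgebraicGeometry.Resolution
open Literature.AlgebraicGeometry.Resolution.CentreBlowup
open Literature.AlgebraicGeometry.Resolution.Hauser2010
open Literature.AlgebraicGeometry.Resolution.HauserPerlega2019

/-! ## 1. The core: an alive-set walk with three letters and one hit per step -/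

section Core

variable {β : Type} [Zero β]

/-- **Every step hits an alive letter**: under the boundary law with `|B k| = |B (k+1)| = 3`, either the chart
letter is alive (re-created) or some alive letter is translated (lost). [folklore] -/
theorem exists_hit_of_law {B : ℕ → Finset (Fin 4)} {j : ℕ → Fin 4} {b : ℕ → Fin 4 → β} {k₀ k : ℕ}
    (hlaw : ∀ k, k₀ ≤ k → ∀ i, i ∈ B (k + 1) ↔ i = j k ∨ (i ∈ B k ∧ b k i = 0))
    (hcard : ∀ k, k₀ ≤ k → (B k).card = 3) (hk : k₀ ≤ k) :
    ∃ x ∈ B k, j k = x ∨ b k x ≠ 0 := by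
  classical
  by_cases hj : j k ∈ B k
  · exact ⟨j k, hj, Or.inl rfl⟩
  · by_contra hno
    push Not at hno
    -- then every alive letter is kept, and `B (k+1) = insert (j k) (B k)` has four elements
    have hsub : insert (j k) (B k) ⊆ B (k + 1) := by
      intro i hi
      rw [Finset.mem_insert] at hi
      rw [hlaw k hk]
      rcases hi with rfl | hi
      · exact Or.inl rfl
      · exact Or.inr ⟨hi, (hno i hi).2⟩
    have h4 := Finset.card_le_card hsub
    rw [Finset.card_insert_of_notMem hj, hcard k hk, hcard (k + 1) (by omega)] at h4
    omega

/-- **The light-tail trichotomy, core form.**  For an alive-set walk `B` with the boundary law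
`i ∈ B (k+1) ↔ i = j k ∨ (i ∈ B k ∧ b k i = 0)` (`k ≥ k₀`) and three alive letters, one of:
(T1) a free tail (`j (k+1) = j k ∨ b (k+1) (j k) ≠ 0` eventually); (T2) one letter `ν` idle for ever (alive,
never the chart, never translated) and every other alive letter born in the stretch; (T3) every alive letter
born in the stretch — where «`i` born at `k`» means `∃ t, k₀ ≤ t < k, j t = i` and `i` kept on `(t, k)`.
Proof: the eventually-permanent letters are `≤ 2` (each step hits an alive non-permanent letter), the others are
born from the last time they were hit (pigeonhole; res-dim4-idea-4 g3). [OURS] [folklore] -/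
theorem light_tail_trichotomy_core {B : ℕ → Finset (Fin 4)} {j : ℕ → Fin 4} {b : ℕ → Fin 4 → β} {k₀ : ℕ}
    (hlaw : ∀ k, k₀ ≤ k → ∀ i, i ∈ B (k + 1) ↔ i = j k ∨ (i ∈ B k ∧ b k i = 0))
    (hcard : ∀ k, k₀ ≤ k → (B k).card = 3) :
    (∃ k₁, k₀ ≤ k₁ ∧ ∀ k, k₁ ≤ k → (j (k + 1) = j k ∨ b (k + 1) (j k) ≠ 0)) ∨
    (∃ ν : Fin 4, ∃ k₁, k₀ ≤ k₁ ∧ (∀ k, k₁ ≤ k → ν ∈ B k ∧ j k ≠ ν ∧ b k ν = 0) ∧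
      (∀ k, k₁ ≤ k → ∀ i, i ≠ ν → i ∈ B k →
        ∃ t, k₀ ≤ t ∧ t < k ∧ j t = i ∧ ∀ m, t < m → m < k → j m ≠ i ∧ b m i = 0)) ∨
    (∃ k₁, k₀ ≤ k₁ ∧ ∀ k, k₁ ≤ k → ∀ i, i ∈ B k →
        ∃ t, k₀ ≤ t ∧ t < k ∧ j t = i ∧ ∀ m, t < m → m < k → j m ≠ i ∧ b m i = 0) := by
  classical
  -- kept / permanent
  let Kept : ℕ → Fin 4 → Prop := fun k i => i ∈ B k ∧ j k ≠ i ∧ b k i = 0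
  let Perm : Fin 4 → Prop := fun i => ∃ m, k₀ ≤ m ∧ ∀ k, m ≤ k → Kept k i
  set P : Finset (Fin 4) := Finset.univ.filter Perm with hP
  -- (a) a common threshold `M ≥ k₀` for the permanent letters
  obtain ⟨M, hMk₀, hM⟩ : ∃ M, k₀ ≤ M ∧ ∀ i ∈ P, ∀ k, M ≤ k → Kept k i := by
    have key : ∀ Q : Finset (Fin 4), Q ⊆ P → ∃ M, k₀ ≤ M ∧ ∀ i ∈ Q, ∀ k, M ≤ k → Kept k i := by
      intro Q
      induction Q using Finset.induction_on with
      | empty => intro _; exact ⟨k₀, le_rfl, fun i hi => absurd hi (Finset.notMem_empty i)⟩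
      | insert a Q ha ih =>
        intro hsub
        obtain ⟨M, hM0, hM⟩ := ih (fun i hi => hsub (Finset.mem_insert_of_mem hi))
        have haP : Perm a := (Finset.mem_filter.mp (hsub (Finset.mem_insert_self a Q))).2
        obtain ⟨m, hm0, hm⟩ := haP
        refine ⟨max M m, le_max_of_le_left hM0, fun i hi k hk => ?_⟩
        rw [Finset.mem_insert] at hi
        rcases hi with rfl | hi
        · exact hm k (le_trans (le_max_right M m) hk)
        · exact hM i hi k (le_trans (le_max_left M m) hk)
    exact key P le_rfl
  -- (b) for `k ≥ M`, `P ⊆ B k` and the hit letter is alive and not permanent, so `|P| ≤ 2`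
  have hPsub : ∀ k, M ≤ k → P ⊆ B k := fun k hk i hi => (hM i hi k hk).1
  have hhit : ∀ k, M ≤ k → ∃ x ∈ B k, x ∉ P ∧ (j k = x ∨ b k x ≠ 0) := by
    intro k hk
    obtain ⟨x, hx, hor⟩ := exists_hit_of_law hlaw hcard (le_trans hMk₀ hk)
    refine ⟨x, hx, fun hxP => ?_, hor⟩
    have hkept := hM x hxP k hk
    rcases hor with h | h
    · exact hkept.2.1 h
    · exact h hkept.2.2
  have hPcard : P.card ≤ 2 := by
    obtain ⟨x, hx, hxP, -⟩ := hhit M le_rfl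
    have hsub : P ⊆ (B M).erase x := fun i hi =>
      Finset.mem_erase.mpr ⟨fun h => hxP (h ▸ hi), hPsub M le_rfl hi⟩
    have h := Finset.card_le_card hsub
    rw [Finset.card_erase_of_mem hx, hcard M hMk₀] at h
    omega
  -- (c) non-permanent letters: a time `≥ k₀` at which they are not kept, below a common bound `k₁`
  have hnp : ∀ i, i ∉ P → ∀ m, k₀ ≤ m → ∃ t, m ≤ t ∧ ¬ Kept t i := by
    intro i hi m hm
    by_contra hall
    push Not at hall
    exact hi (Finset.mem_filter.mpr ⟨Finset.mem_univ i, m, hm, fun k hk => hall k hk⟩)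
  obtain ⟨k₁, hk₁M, hk₁⟩ : ∃ k₁, M ≤ k₁ ∧ ∀ i, i ∉ P → ∃ t, k₀ ≤ t ∧ t < k₁ ∧ ¬ Kept t i := by
    have key : ∀ Q : Finset (Fin 4), ∃ k₁, M ≤ k₁ ∧ ∀ i ∈ Q, i ∉ P → ∃ t, k₀ ≤ t ∧ t < k₁ ∧ ¬ Kept t i := by
      intro Q
      induction Q using Finset.induction_on with
      | empty => exact ⟨M, le_rfl, fun i hi => absurd hi (Finset.notMem_empty i)⟩
      | insert a Q ha ih =>
        obtain ⟨k₁, hk₁M, hk₁⟩ := ih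
        by_cases haP : a ∈ P
        · refine ⟨k₁, hk₁M, fun i hi hiP => ?_⟩
          rw [Finset.mem_insert] at hi
          rcases hi with rfl | hi
          · exact absurd haP hiP
          · exact hk₁ i hi hiP
        · obtain ⟨t, ht0, ht⟩ := hnp a haP k₀ le_rfl
          refine ⟨max k₁ (t + 1), le_trans hk₁M (le_max_left _ _), fun i hi hiP => ?_⟩
          rw [Finset.mem_insert] at hi
          rcases hi with rfl | hi
          · exact ⟨t, ht0, by omega, ht⟩
          · obtain ⟨t', ht'0, ht'lt, ht'⟩ := hk₁ i hi hiP
            exact ⟨t', ht'0, by omega, ht'⟩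
    obtain ⟨k₁, hk₁M, hk₁⟩ := key Finset.univ
    exact ⟨k₁, hk₁M, fun i hiP => hk₁ i (Finset.mem_univ i) hiP⟩
  have hk₁k₀ : k₀ ≤ k₁ := le_trans hMk₀ hk₁M
  -- (d) BORN: an alive non-permanent letter at `k ≥ k₁` was created at the last time it was not kept
  have hborn : ∀ k, k₁ ≤ k → ∀ i, i ∉ P → i ∈ B k →
      ∃ t, k₀ ≤ t ∧ t < k ∧ j t = i ∧ ∀ m, t < m → m < k → j m ≠ i ∧ b m i = 0 := by
    intro k hk i hiP hiB
    -- the last `t < k` with `k₀ ≤ t` and `¬ Kept t i`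
    set S : Finset ℕ := (Finset.range k).filter (fun t => k₀ ≤ t ∧ ¬ Kept t i) with hS
    have hSne : S.Nonempty := by
      obtain ⟨t, ht0, htlt, ht⟩ := hk₁ i hiP
      exact ⟨t, Finset.mem_filter.mpr ⟨Finset.mem_range.mpr (by omega), ht0, ht⟩⟩
    set t := S.max' hSne with ht
    have htS : t ∈ S := Finset.max'_mem S hSne
    have hmem := Finset.mem_filter.mp htS
    have htlt : t < k := Finset.mem_range.mp hmem.1
    have ht0 : k₀ ≤ t := hmem.2.1
    have htnk : ¬ Kept t i := hmem.2.2
    have hkept : ∀ m, t < m → m < k → Kept m i := by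
      intro m htm hmk
      by_contra hm
      have hmS : m ∈ S := Finset.mem_filter.mpr ⟨Finset.mem_range.mpr hmk, by omega, hm⟩
      have := Finset.le_max' S m hmS
      rw [← ht] at this
      omega
    -- `i ∈ B (t+1)`
    have hiB1 : i ∈ B (t + 1) := by
      by_cases h : t + 1 < k
      · exact (hkept (t + 1) (by omega) h).1
      · have : t + 1 = k := by omega
        rw [this]; exact hiB
    -- the law at `t` forces `j t = i`
    have hjt : j t = i := by
      rcases (hlaw t ht0 i).mp hiB1 with h | ⟨hBt, hbt⟩
      · exact h.symm
      · by_contra hne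
        exact htnk ⟨hBt, hne, hbt⟩
    exact ⟨t, ht0, htlt, hjt, fun m htm hmk => ⟨(hkept m htm hmk).2.1, (hkept m htm hmk).2.2⟩⟩
  -- (e) the three cases `|P| = 2, 1, 0`
  rcases Nat.lt_or_ge P.card 1 with h0 | h1
  · -- |P| = 0: (T3)
    right; right
    refine ⟨k₁, hk₁k₀, fun k hk i hi => hborn k hk i ?_ hi⟩
    intro hiP
    have : 0 < P.card := Finset.card_pos.mpr ⟨i, hiP⟩
    omega
  rcases Nat.lt_or_ge P.card 2 with h1' | h2
  · -- |P| = 1: (T2)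
    right; left
    obtain ⟨ν, hν⟩ := Finset.card_eq_one.mp (by omega : P.card = 1)
    have hνP : ν ∈ P := by rw [hν]; exact Finset.mem_singleton_self ν
    refine ⟨ν, k₁, hk₁k₀, fun k hk => hM ν hνP k (le_trans hk₁M hk), fun k hk i hiν hi => hborn k hk i ?_ hi⟩
    intro hiP
    rw [hν, Finset.mem_singleton] at hiP
    exact hiν hiP
  · -- |P| = 2: (T1)
    left
    have hP2 : P.card = 2 := le_antisymm hPcard h2
    refine ⟨k₁, hk₁k₀, fun k hk => ?_⟩
    -- at step `k+1` the hit letter is the unique alive non-permanent letter, which is `j k`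
    have hk0 : k₀ ≤ k := le_trans hk₁k₀ hk
    have hjB : j k ∈ B (k + 1) := (hlaw k hk0 (j k)).mpr (Or.inl rfl)
    have hjP : j k ∉ P := by
      intro hjP
      exact (hM (j k) hjP k (le_trans hk₁M hk)).2.1 rfl
    obtain ⟨x, hxB, hxP, hor⟩ := hhit (k + 1) (by omega)
    -- `B (k+1) ⊇ P ∪ {j k, x}` with `|B (k+1)| = 3`, `|P| = 2` ⇒ `x = j k`
    have hx : x = j k := by
      by_contra hne
      have hsub : insert x (insert (j k) P) ⊆ B (k + 1) := by
        intro i hi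
        rw [Finset.mem_insert, Finset.mem_insert] at hi
        rcases hi with rfl | rfl | hi
        · exact hxB
        · exact hjB
        · exact hPsub (k + 1) (by omega) hi
      have h := Finset.card_le_card hsub
      rw [Finset.card_insert_of_notMem (by rw [Finset.mem_insert]; push Not; exact ⟨hne, hxP⟩),
        Finset.card_insert_of_notMem hjP, hP2, hcard (k + 1) (by omega)] at h
      omega
    rw [hx] at hor
    exact hor

end Core

/-! ## 2. The dress: witnessed isolated above-floor chains -/

section Chain

variable {K : Type} [Field K] [DecidableEq K]

/-- **The boundary law along a witnessed above-floor chain**: a letter is alive at `k+1` iff it is the chart letter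
(new weight `o_k − p ≥ 1`) or it was alive and untranslated (`step_r_univ'`). [folklore] -/
theorem mem_support_r_succ_iff (p : ℕ) [Fact p.Prime] {c : ℕ → State K} {j : ℕ → Fin 4} {b : ℕ → Fin 4 → K}
    (hc : ∀ k, IsIsolated p (c k).F ∧ Step0 p (c k) (c (k + 1))) (hw : FreeTail.IsWitnessedChain p c j b)
    (hfloor : ∀ k, ordZero (c k).F ≠ p) (k : ℕ) (i : Fin 4) :
    i ∈ (c (k + 1)).r.support ↔ i = j k ∨ (i ∈ (c k).r.support ∧ b k i = 0) := by
  obtain ⟨o, ho, hpo, -⟩ := chain_band p hc hfloor k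
  have h1 : (c (k + 1)).r = ((c k).r.filter (fun i => b k i = 0)).update (j k) (o - p) := by
    rw [(hw k).2.2.2.2]
    exact step_r_univ' p (j k) (b k) (c k) ho
  rw [Finsupp.mem_support_iff, Finsupp.mem_support_iff, h1, Finsupp.coe_update]
  by_cases hij : i = j k
  · rw [hij, Function.update_self]
    constructor
    · intro _; exact Or.inl rfl
    · intro _; omega
  · rw [Function.update_of_ne hij, Finsupp.filter_apply]
    constructor
    · intro h
      by_cases hb : b k i = 0
      · rw [if_pos hb] at h; exact Or.inr ⟨h, hb⟩
      · rw [if_neg hb] at h; exact absurd rfl h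
    · rintro (h | ⟨h, hb⟩)
      · exact absurd h hij
      · rw [if_pos hb]; exact h

/-- **THE LIGHT-TAIL TRICHOTOMY** (brick K26b; res-dim4-idea-4 g3's `light_tail_trichotomy`): along a witnessed
isolated above-floor `Step0 p` chain with exactly THREE alive boundary letters from `k₀` on, one of
(T1) a free tail — `¬ IsSatellite j b k` for all large `k` (then FT `noIsolatedFreeTailAt_self` ends the chain);
(T2) one letter `ν` idle for ever and every other alive letter born in the stretch (the C∞ / K24 entry);
(T3) every alive letter born in the stretch (the A∞ / K25 entry).  «Born at `k`»: `∃ t, k₀ ≤ t < k ∧ j t = i ∧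
∀ m ∈ (t, k), j m ≠ i ∧ b m i = 0`.  `hwt` of the card is weakened to `|supp r_k| = 3`. [OURS] [folklore] -/
theorem light_tail_trichotomy (p : ℕ) [Fact p.Prime] {c : ℕ → State K} {j : ℕ → Fin 4} {b : ℕ → Fin 4 → K}
    (hc : ∀ k, IsIsolated p (c k).F ∧ Step0 p (c k) (c (k + 1))) (hw : FreeTail.IsWitnessedChain p c j b)
    (hfloor : ∀ k, ordZero (c k).F ≠ p) {k₀ : ℕ} (hB3 : ∀ k, k₀ ≤ k → (c k).r.support.card = 3) :
    (∃ k₁, k₀ ≤ k₁ ∧ ∀ k, k₁ ≤ k → ¬ FreeTail.IsSatellite j b k) ∨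
    (∃ ν : Fin 4, ∃ k₁, k₀ ≤ k₁ ∧ (∀ k, k₁ ≤ k → 1 ≤ (c k).r ν ∧ j k ≠ ν ∧ b k ν = 0) ∧
      (∀ k, k₁ ≤ k → ∀ i, i ≠ ν → 1 ≤ (c k).r i →
        ∃ t, k₀ ≤ t ∧ t < k ∧ j t = i ∧ ∀ m, t < m → m < k → j m ≠ i ∧ b m i = 0)) ∨
    (∃ k₁, k₀ ≤ k₁ ∧ ∀ k, k₁ ≤ k → ∀ i, 1 ≤ (c k).r i →
        ∃ t, k₀ ≤ t ∧ t < k ∧ j t = i ∧ ∀ m, t < m → m < k → j m ≠ i ∧ b m i = 0) := by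
  have hlaw : ∀ k, k₀ ≤ k → ∀ i, i ∈ (c (k + 1)).r.support ↔ i = j k ∨ (i ∈ (c k).r.support ∧ b k i = 0) :=
    fun k _ i => mem_support_r_succ_iff p hc hw hfloor k i
  have halive : ∀ k i, 1 ≤ (c k).r i ↔ i ∈ (c k).r.support := fun k i => by
    rw [Finsupp.mem_support_iff]; omega
  rcases light_tail_trichotomy_core (B := fun k => (c k).r.support) hlaw hB3 with
    ⟨k₁, hk₁, h⟩ | ⟨ν, k₁, hk₁, hν, h⟩ | ⟨k₁, hk₁, h⟩
  · left
    refine ⟨k₁, hk₁, fun k hk hsat => ?_⟩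
    rcases h k hk with h | h
    · exact hsat.1 h
    · exact h hsat.2
  · right; left
    refine ⟨ν, k₁, hk₁, fun k hk => ?_, fun k hk i hi hri => h k hk i hi ((halive k i).mp hri)⟩
    obtain ⟨h1, h2, h3⟩ := hν k hk
    exact ⟨(halive k ν).mpr h1, h2, h3⟩
  · right; right
    exact ⟨k₁, hk₁, fun k hk i hri => h k hk i ((halive k i).mp hri)⟩

end Chain

end ResCone

end Summit.ResolutionOfSingularities.ResolutionOfSingularities.Theorems.PIDim4
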